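import Literature.Analysis.FluidPDE.GalerkinFlow
import Literature.Analysis.FluidPDE.NSGalerkinFamilyLimit
import Summits.AnomalousDissipation.AnomalousDissipation.Theorems.CubicParityLoud.Negative.Clauses
import HarnessLib

/-!
# Stub `stub_boundedOrders` for line `enstrophy-ui-transfer` (crux `MomentParity.ResolvedDissipation`, stmt-AnomalousDissipation-14284)

Sorry-free discharge of the registered stub `stub_boundedOrders` (S7) of the lead's skeleton:
**at bounded Galerkin order the enstrophy of the Galerkin orbits issued from the `L²`-ball is
bounded on a window.** For `ν ≥ 0`, a smooth steady force `f` on `T³`, a radius `R`, an order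
bound `N₀` and a window `T ≥ 0` there is ONE finite `M` with `‖∇ S^N_t a‖² ≤ M` for every order
`N ≤ N₀`, every Galerkin mode `a` of order `N` with `∫‖a‖² ≤ R²` and every `t ∈ [0, T]`
(`S^N_t = Torus.galerkinFlow ν f N t`, the Galerkin semiflow of order `N`).

**Proof.**
* `integral_norm_sq_galerkinFlow_le` — the `L²` norm along the orbit is bounded on `[0, T']`
  (`T' > 0`) by `2∫‖a‖² + 4T'²∫‖f‖²`, WITHOUT Grönwall, exactly as the tree's
  `IsHopfGalerkinFamily.integral_norm_sq_le` (Robinson–Rodrigo–Sadowski 2016, Thm. 4.4 Step 3,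
  (4.8)): take the maximum `Y` of the continuous slice energy `τ ↦ ∫‖S_τ a‖²` on `[0, T']`
  (joint continuity of the orbit, `IsGalerkinMode.galerkinFlow_clauses`), write the exact energy
  identity of the orbit from `0` to the argmax (last clause of `galerkinFlow_clauses`), drop the
  dissipation `ν∫‖∇S‖² ≥ 0`, and bound the work by Young under the integral
  (`integral_inner_slice_le_young` with `η = (2T')⁻¹`): `∫₀^{t₁}∫⟪f, S_τ a⟫ ≤ T'²∫‖f‖² + Y/4`,
  whence `Y/2 ≤ ∫‖a‖²/2 + T'²∫‖f‖² + Y/4`.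
* `eGradNormSq_le_of_isGalerkinMode` — BERNSTEIN for Galerkin modes of order `N`:
  `‖∇v‖² = 4π² Σ_{|k|≤N} |k|²‖v̂ k‖² ≤ 4π²N² Σ_{|k|≤N} ‖v̂ k‖² = 4π²N²∫‖v‖²`
  (`Torus.eGradNormSq_eq_sum_of_band_limited`, `Torus.mem_freqBall`,
  `Torus.integral_norm_sq_eq_sum_of_band_limited`).
* Assembly with the window `T' := T + 1 > 0`, the invariance of the Galerkin modes under the
  semiflow (`IsGalerkinMode.isGalerkinMode_galerkinFlow`) and `N² ≤ N₀²`: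
  `M := ofReal (4π²N₀² (2R² + 4(T+1)²∫‖f‖²))`.

References: J. C. Robinson, J. L. Rodrigo, W. Sadowski, *The three-dimensional Navier–Stokes
equations* (CUP 2016), §4.1, Thm. 4.4 Steps 2–3, (4.6)–(4.8); P. Constantin, C. Foias,
*Navier–Stokes Equations* (Chicago 1988), Ch. 8, (8.7)–(8.12).
-/

noncomputable section

-- `Summit.<Summit>.<Problem>`: single-conjunct summit, the duplicate namespace segment is mandated.
set_option linter.dupNamespace false

namespace Summit.AnomalousDissipation.AnomalousDissipation.Theorems.MomentParityResolvedDissipation.BoundedOrders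

open MeasureTheory Filter Topology Set
open scoped ENNReal InnerProductSpace RealInnerProductSpace
open Literature.Analysis.FunctionSpaces Literature.Analysis.FluidPDE
open Summit.AnomalousDissipation.AnomalousDissipation.Theorems.CubicParityLoud.Negative (T3 R3)

/-- **Bernstein for Galerkin modes.** A Galerkin mode `v` of order `N` on `T³` (continuous and
band-limited to `|k|² ≤ N²`) has `‖∇v‖₂² ≤ 4π²N² ∫‖v‖²`: by
`Torus.eGradNormSq_eq_sum_of_band_limited`, `‖∇v‖² = 4π² Σ_{|k|≤N} |k|² ‖v̂ k‖²`, each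
`|k|² ≤ N²` on the frequency ball (`Torus.mem_freqBall`), and `Σ_{|k|≤N} ‖v̂ k‖² = ∫‖v‖²`
(`Torus.integral_norm_sq_eq_sum_of_band_limited`). [folklore; Robinson–Rodrigo–Sadowski 2016, §4.1] -/
theorem eGradNormSq_le_of_isGalerkinMode {N : ℕ} {v : T3 → R3} (hv : IsGalerkinMode N v) :
    Torus.eGradNormSq v ≤ ENNReal.ofReal (4 * Real.pi ^ 2 * (N : ℝ) ^ 2 * ∫ x, ‖v x‖ ^ 2) := by
  have hc : Continuous v := hv.isSmooth.continuous
  have hband : ∀ k : Fin 3 → ℤ, (N : ℝ) ^ 2 < Torus.freqNormSq k →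
      UnitAddTorus.mFourierCoeff (EuclideanSpace.complexify ∘ v) k = 0 :=
    fun k hk => hv.mFourierCoeff_eq_zero hk
  rw [Torus.eGradNormSq_eq_sum_of_band_limited hc hband,
    Torus.integral_norm_sq_eq_sum_of_band_limited hc hband]
  refine ENNReal.ofReal_le_ofReal ?_
  have hsum : ∑ k ∈ Torus.freqBall N, Torus.freqNormSq k *
        ‖UnitAddTorus.mFourierCoeff (EuclideanSpace.complexify ∘ v) k‖ ^ 2 ≤
      (N : ℝ) ^ 2 * ∑ k ∈ Torus.freqBall N,
        ‖UnitAddTorus.mFourierCoeff (EuclideanSpace.complexify ∘ v) k‖ ^ 2 := by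
    rw [Finset.mul_sum]
    exact Finset.sum_le_sum fun k hk =>
      mul_le_mul_of_nonneg_right (Torus.mem_freqBall.1 hk) (sq_nonneg _)
  calc 4 * Real.pi ^ 2 * ∑ k ∈ Torus.freqBall N, Torus.freqNormSq k *
          ‖UnitAddTorus.mFourierCoeff (EuclideanSpace.complexify ∘ v) k‖ ^ 2
      ≤ 4 * Real.pi ^ 2 * ((N : ℝ) ^ 2 * ∑ k ∈ Torus.freqBall N,
          ‖UnitAddTorus.mFourierCoeff (EuclideanSpace.complexify ∘ v) k‖ ^ 2) :=
        mul_le_mul_of_nonneg_left hsum (by positivity)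
    _ = 4 * Real.pi ^ 2 * (N : ℝ) ^ 2 * ∑ k ∈ Torus.freqBall N,
          ‖UnitAddTorus.mFourierCoeff (EuclideanSpace.complexify ∘ v) k‖ ^ 2 := by ring

/-- **Uniform `L²` bound along a Galerkin orbit on a window** (Robinson–Rodrigo–Sadowski 2016,
Thm. 4.4 Step 3, (4.8); Constantin–Foias 1988, (8.10)–(8.12)), without Grönwall: for `ν ≥ 0`, a
smooth steady force `f`, a Galerkin mode `a` of order `N` and `T > 0`,
`∫‖S^N_t a‖² ≤ 2∫‖a‖² + 4T²∫‖f‖²` for all `t ∈ [0, T]` — the exact energy identity of the orbit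
from `0` to the argmax `t₁` of the continuous slice energy on `[0, T]`, the dissipation dropped,
and Young under the integral with `η = (2T)⁻¹` for the work of `f`. Adapted clause by clause
from the tree's `IsHopfGalerkinFamily.integral_norm_sq_le` / `.force_work_le`.
[cite: RobinsonRodrigoSadowski2016, Thm. 4.4 Step 3 (4.8)] -/
theorem integral_norm_sq_galerkinFlow_le {ν : ℝ} (hν : 0 ≤ ν) {f : T3 → R3}
    (hf : Torus.IsSmooth f) {N : ℕ} {a : T3 → R3} (ha : IsGalerkinMode N a) {T : ℝ}
    (hT : 0 < T) {t : ℝ} (ht : t ∈ Icc 0 T) :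
    ∫ x, ‖Torus.galerkinFlow ν f N t a x‖ ^ 2 ≤
      2 * (∫ x, ‖a x‖ ^ 2) + 4 * T ^ 2 * ∫ x, ‖f x‖ ^ 2 := by
  obtain ⟨h0, hUc, -, -, hE⟩ := ha.galerkinFlow_clauses (ν := ν) (f := f) hν (hf.memLp 2)
  -- the steady force has a continuous space–time lift
  have hFc : ContinuousOn (Torus.stLift (fun _ : ℝ => f))
      (Ici 0 ×ˢ (univ : Set (EuclideanSpace ℝ (Fin 3)))) :=
    (show Continuous fun p : ℝ × EuclideanSpace ℝ (Fin 3) => f (Torus.proj p.2) from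
      hf.continuous.comp (Torus.continuous_proj.comp continuous_snd)).continuousOn
  -- the maximum of the slice energy on `[0, T]`
  have hyc : ContinuousOn (fun τ => ∫ x, ‖Torus.galerkinFlow ν f N τ a x‖ ^ 2) (Icc 0 T) :=
    (Torus.continuousOn_integral_norm_sq_of_continuousOn_stLift hUc).mono
      fun τ hτ => mem_Ici.2 hτ.1
  obtain ⟨t₁, ht₁, hmax⟩ := isCompact_Icc.exists_isMaxOn (nonempty_Icc.2 hT.le) hyc
  -- energy identity from `0` to `t₁`, in terms of `∫ ‖·‖²`
  have hE' := hE 0 t₁ le_rfl ht₁.1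
  rw [h0] at hE'
  simp only [Torus.kineticEnergy] at hE'
  set Y := ∫ x, ‖Torus.galerkinFlow ν f N t₁ a x‖ ^ 2 with hYdef
  have hY : ∀ τ ∈ Icc 0 T, ∫ x, ‖Torus.galerkinFlow ν f N τ a x‖ ^ 2 ≤ Y := fun τ hτ => hmax hτ
  have hY0 : 0 ≤ Y := integral_nonneg fun x => by positivity
  have hΦ0 : 0 ≤ ∫ x, ‖f x‖ ^ 2 := integral_nonneg fun x => by positivity
  -- pointwise Young on `[0, t₁]` with `η = (2T)⁻¹`
  have hη : (0 : ℝ) < (2 * T)⁻¹ := by positivity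
  have h2T : (2 * (2 * T)⁻¹)⁻¹ = T := by field_simp
  have hpt : ∀ τ ∈ Icc 0 t₁, ∫ x, ⟪f x, Torus.galerkinFlow ν f N τ a x⟫ ≤
      T * (∫ x, ‖f x‖ ^ 2) + (2 * T)⁻¹ / 2 * Y := by
    intro τ hτ
    have h := integral_inner_slice_le_young hFc hUc hτ.1 hη
    rw [h2T] at h
    refine h.trans ?_
    gcongr
    exact hY τ ⟨hτ.1, hτ.2.trans ht₁.2⟩
  -- the work of `f` on `[0, t₁]`
  have hPc : ContinuousOn (fun τ => ∫ x, ⟪f x, Torus.galerkinFlow ν f N τ a x⟫) (Icc 0 t₁) :=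
    (Torus.continuousOn_integral_inner_of_continuousOn_stLift hFc hUc).mono
      fun τ hτ => mem_Ici.2 hτ.1
  have hC0 : 0 ≤ T * (∫ x, ‖f x‖ ^ 2) + (2 * T)⁻¹ / 2 * Y := by positivity
  have hW : ∫ τ in (0 : ℝ)..t₁, ∫ x, ⟪f x, Torus.galerkinFlow ν f N τ a x⟫ ≤
      T ^ 2 * (∫ x, ‖f x‖ ^ 2) + Y / 4 := by
    have h := intervalIntegral.integral_mono_on ht₁.1
      ((hPc.mono (by rw [uIcc_of_le ht₁.1])).intervalIntegrable)
      (intervalIntegrable_const (μ := volume)) hpt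
    rw [intervalIntegral.integral_const, smul_eq_mul, sub_zero] at h
    refine h.trans ?_
    calc t₁ * (T * (∫ x, ‖f x‖ ^ 2) + (2 * T)⁻¹ / 2 * Y)
        ≤ T * (T * (∫ x, ‖f x‖ ^ 2) + (2 * T)⁻¹ / 2 * Y) :=
          mul_le_mul_of_nonneg_right ht₁.2 hC0
      _ = T ^ 2 * (∫ x, ‖f x‖ ^ 2) + Y / 4 := by
          field_simp
          ring
  -- drop the dissipation and conclude `Y ≤ 2∫‖a‖² + 4T²∫‖f‖²`
  have hD : 0 ≤ ν * (∫⁻ τ in Ioo 0 t₁,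
      Torus.eGradNormSq (Torus.galerkinFlow ν f N τ a)).toReal :=
    mul_nonneg hν ENNReal.toReal_nonneg
  have hYle : Y ≤ 2 * (∫ x, ‖a x‖ ^ 2) + 4 * T ^ 2 * ∫ x, ‖f x‖ ^ 2 := by linarith
  exact (hY t ht).trans hYle

/-- **S7 · `stub_boundedOrders` — at bounded Galerkin order the enstrophy of orbits from the
`L²`-ball is bounded on a window.** For `ν ≥ 0`, a smooth steady force `f`, a radius `R`, an
order bound `N₀` and a window `T ≥ 0` there is a finite `M` with `‖∇S^N_t a‖² ≤ M` for all
`N ≤ N₀`, all Galerkin modes `a` of order `N` with `∫‖a‖² ≤ R²` and all `t ∈ [0, T]`: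
`M := ofReal (4π²N₀² (2R² + 4(T+1)²∫‖f‖²))`, by the uniform `L²` bound along the orbit on the
window `[0, T + 1]` (`integral_norm_sq_galerkinFlow_le`), the invariance of the Galerkin modes of
order `N` under the semiflow (`IsGalerkinMode.isGalerkinMode_galerkinFlow`) and Bernstein at order
`N ≤ N₀` (`eGradNormSq_le_of_isGalerkinMode`). [folklore; Robinson–Rodrigo–Sadowski 2016, Thm. 4.4 Steps 2–3] -/
theorem stub_boundedOrders (ν : ℝ) (hν : 0 ≤ ν) (f : T3 → R3) (hf : Torus.IsSmooth f) (R : ℝ) (N₀ : ℕ)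
    (T : ℝ) (hT : 0 ≤ T) :
    ∃ M : ℝ≥0∞, M ≠ ⊤ ∧ ∀ (N : ℕ), N ≤ N₀ → ∀ (a : T3 → R3), IsGalerkinMode N a →
      ∫ x, ‖a x‖ ^ 2 ≤ R ^ 2 →
      ∀ t ∈ Set.Icc (0 : ℝ) T, Torus.eGradNormSq (Torus.galerkinFlow ν f N t a) ≤ M := by
  refine ⟨ENNReal.ofReal (4 * Real.pi ^ 2 * (N₀ : ℝ) ^ 2 *
      (2 * R ^ 2 + 4 * (T + 1) ^ 2 * ∫ x, ‖f x‖ ^ 2)), ENNReal.ofReal_ne_top,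
    fun N hN a ha haR t ht => ?_⟩
  have hT1 : 0 < T + 1 := by linarith
  have ht' : t ∈ Icc 0 (T + 1) := ⟨ht.1, ht.2.trans (by linarith)⟩
  set v : T3 → R3 := Torus.galerkinFlow ν f N t a with hv
  -- the slice is a Galerkin mode of order `N`, with `L²` norm bounded on the window
  have hslice : IsGalerkinMode N v := ha.isGalerkinMode_galerkinFlow t
  have hL2 : ∫ x, ‖v x‖ ^ 2 ≤ 2 * R ^ 2 + 4 * (T + 1) ^ 2 * ∫ x, ‖f x‖ ^ 2 :=
    (integral_norm_sq_galerkinFlow_le hν hf ha hT1 ht').trans (by gcongr)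
  have hI0 : 0 ≤ ∫ x, ‖v x‖ ^ 2 := integral_nonneg fun x => by positivity
  have hNN : (N : ℝ) ^ 2 ≤ (N₀ : ℝ) ^ 2 := by gcongr
  have hkey : (N : ℝ) ^ 2 * ∫ x, ‖v x‖ ^ 2 ≤
      (N₀ : ℝ) ^ 2 * (2 * R ^ 2 + 4 * (T + 1) ^ 2 * ∫ x, ‖f x‖ ^ 2) :=
    mul_le_mul hNN hL2 hI0 (by positivity)
  refine (eGradNormSq_le_of_isGalerkinMode hslice).trans (ENNReal.ofReal_le_ofReal ?_)
  calc 4 * Real.pi ^ 2 * (N : ℝ) ^ 2 * ∫ x, ‖v x‖ ^ 2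
      = 4 * Real.pi ^ 2 * ((N : ℝ) ^ 2 * ∫ x, ‖v x‖ ^ 2) := by ring
    _ ≤ 4 * Real.pi ^ 2 * ((N₀ : ℝ) ^ 2 * (2 * R ^ 2 + 4 * (T + 1) ^ 2 * ∫ x, ‖f x‖ ^ 2)) :=
        mul_le_mul_of_nonneg_left hkey (by positivity)
    _ = 4 * Real.pi ^ 2 * (N₀ : ℝ) ^ 2 * (2 * R ^ 2 + 4 * (T + 1) ^ 2 * ∫ x, ‖f x‖ ^ 2) := by
        ring

end Summit.AnomalousDissipation.AnomalousDissipation.Theorems.MomentParityResolvedDissipation.BoundedOrders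

end
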